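import Summits.QuantumFields.BalabanUV.T4Continuum.Spine.NE1p.DressedMGFFormChain
import Summits.QuantumFields.BalabanUV.T4Continuum.Spine.NE1p.DressedMGFForm

/-!
# YM-DAG node N19 (= NE7 proper) — ROW MF-ID, GENERIC HALF: HETEROGENEOUS TREE-INDEXED KERNEL TOWERS ARE OF MGF FORM (`DressedMGFForm.MGFForm`
# off ONE space and off ONE lineage), the kernel-dual class measure `ν` EXPLICIT, and the real-valued (Bochner) bridge in def-T's junk convention — the
# history kernels CHARACTERISED by their two recursion equations, no object declared

Cell `pub-ymgap`, HUMAN RULING D-0062 (Track A), R141 (C) wider-strategy seat `pub-ymgap-dag-n19-e` (strategy s3 = ALTERNATIVE CURRENCY), twelfth module of the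
seat (sibling `…N19MGFFormKernelChainRStep.lean` = MF-R generic, filed first under the 400-line rule).  ROW MF-ID of the LENS decomp v5 (`ym-lens-BalabanUVNodes-decomp`
g5, memo `LENS-decomp.md` v5 07acd831aa830b9f §v5.2 ∕ §v5.5, sketch `LensDecompNE7v5.sketch.lean` a021c8a8f95b66cf), SPLIT by dag-lead WORDS-125 ∕ 126 ∕ 131
(pub-ymgap INBOX l.15615 ∕ l.15621 ∕ l.15764, REBALANCE №65): THIS file is the ABSTRACT layer of the GENERIC half (b) — piece MF-Σ, the level-indexed heterogeneous
kernel chain ⇒ `MGFForm`; the AT-RECORD half (c) — the F3-OBJECT layer: the measure-valued slot recursion over `Node00.texpAOfRecordFrom`, MF-T on def-T's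
`tstepOfRecord`, MF-R at the selectors of record, `mgfForm_classWeightOfDatum₉_of_ppSelId` — is `dag-n19-d`'s `…N19MGFKernelTower` ∕ `…N19MGFFormAtRecord` and MEETS
this file exactly once (WORDS-131 (1) HANDSHAKE, INBOX l.15817: its history measures, measurable in the coarse field, ARE Mathlib kernels and are fed to the
theorems below through the two recursion equations `hK0` ∕ `hKs`; its `[finite]` guard is the proviso `hfin` of §1b); the K14-β GUARD− (a) is `dag-n19-c`'s.  Nothing
`…OfRecord`, no `classWeightOfDatum₉`, no selector of record, no `tstepOfRecord` occurs below; general measurable spaces; NO `def` (the history kernels are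
characterised, not constructed — the construction is the F3-object layer's own recursion).

WHY.  The MGF road to N19's dressed `Core` (`…N19VacuumMGFRoad` :228 ∕ :325, `…N19VacuumK5MGFRoad` :90 ∕ :109) displays ONE hypothesis:
`DressedMGFForm.MGFForm Bo S.T Fo ν (fun K t τ ↦ S.A K t τ − S.shA K t τ)` — every shell-free dressed class term is the moment generating function of ONE bounded
observable under a t-FREE class measure.  The tree proves this shape along ONE lineage on ONE space (`DressedMGFFormChain.toReal_lintegral_iter_dressed_eq_mgf`
:166: `iter Φ` of kernel-represented maps `X → X`).  NODE 00's F3 dressed tower (`Node00.dressedSlotsOfDatum₉`, n20-e lineage) is neither: the field space CHANGES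
with the level (`GaugeField (F.P p.K) k (SU N)`, one per `k`) and the slot of a sequence `s′` of length `k+1` is the T-step image of the slot of its PARENT `init s′`
(def-T's (†) `tstepOfRecord_apply` :290: `margDensity(V′) · ∫ … ∂condLaw(V′)`, a BOCHNER integral) times the R-step's own-ratio (def-R's `rstepOfSel`, [Balaban1989LargeFieldI]
(0.3) p. 176 — a t-free `{0,1}`-multiplier at the identity selector, sibling file).  §1 supplies the chain lemma in exactly that generality; §1b the passage from
Bochner-integral slot families to the `ℝ≥0∞` tower WITHOUT an integrability binder (def-T's junk convention `toReal ∞ = 0` is matched, not assumed away).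

WHAT IS PROVED (Mathlib `ProbabilityTheory.Kernel` ∕ `Measure.bind` ∕ `withDensity` bookkeeping; every declaration [folklore] ∕ bookkeeping).
* §1 MF-Σ.  Data: measurable spaces `X n` (level `n`), index types `ι n` with parent maps `init n : ι (n+1) → ι n`, t-FREE step kernels
  `κ n s′ : Kernel (X (n+1)) (X n)` (a measurable measure-valued map IS a Mathlib kernel), and history kernels `K n s : Kernel (X n) (X 0)` with
  `hK0 : K 0 s = Kernel.id`, `hKs : K (n+1) s′ = K n (init s′) ∘ₖ κ n s′` (`histKernel_succ_apply`: «level n+1 at `V′` = (step measure at `V′`).bind (level n at the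
  parent)», `Kernel.comp_apply`);  ★ `slot_eq_lintegral_histKernel`: a slot family `T : ∀ n, ι n → X n → ℝ≥0∞` with `T 0 s = f₀` and
  `T (n+1) s′ = (y ↦ ∫⁻ T n (init s′) ∂κ n s′ y)` IS `y ↦ ∫⁻ f₀ ∂(K n s y)` — the start pushed through the history kernel (`DressedMGFFormChain.isKernelRepr_iter`
  off one space, off one lineage); `measurable_slot`; `lintegral_mul_slot_eq_lintegral_bind` (the class weight `∫⁻ χ·T n s dμ` is `∫⁻ f₀` against
  `(μ.withDensity χ).bind (K n s)`);  ★ `toReal_lintegral_mul_slot_dressed_eq_mgf`: started at the DRESSED start `ρ₀·e^{tF}` the class weight of EVERY history is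
  `mgf F ν t` under THE KERNEL-DUAL CLASS MEASURE `ν = (((μ.withDensity χ).bind (K n s)).withDensity ρ₀)` — t-free by construction, NOTE N14-ν's object in abstract
  form (both sides `0` together when infinite); `isFiniteMeasure_kernelDual_of_lintegral_ne_top` (ν finite ⇐ the UNDRESSED class weight `≠ ∞`); `kernelDual_univ`
  (its mass IS that weight); `lintegral_histKernel_eq_slot`; `mgfForm_of_kernelTowers` (run-indexed packaging into `DressedMGFForm.MGFForm B T F ν A`, NO
  integrability binder).
* §1b THE REAL-VALUED BRIDGE (F3's slots are Bochner integrals), junk-matched: `lintegral_histKernel_tower`; `lintegral_dressed_ne_top`;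
  ★ `realSlot_eq_toReal_slot` — a real slot family with `Tr 0 s = (f₀ ·).toReal` and `Tr (n+1) s′ y = ∫ Tr n (init s′) ∂(κ n s′ y)` IS `toReal` of the `ℝ≥0∞`
  tower, the ONLY proviso being on the kernels (`hfin`: every history gives the undressed start finite mass — t-free); `realSlot_nonneg_measurable`;
  ★ `integral_mul_realSlot_dressed_eq_mgf`: the BOCHNER class weight `∫ χ·Tr n s dμ` of a dressed real tower is `mgf F ν t` for every measurable real `χ ≥ 0` — the
  literal shape of `Node00.classWeightOfDatum₉`.

HONEST FRAMING — what this is NOT.  `MGFForm` AT THE RECORD is NOT discharged here (that is module (c)); nothing of Bałaban's is instantiated ([IV] (0.3) p. 176 ∕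
[III] (3.1) p. 264 named for the SHAPE of def-R's ∕ def-T's steps only); NE7 ∕ NE1′ ∕ `TiltedMeanMatching` NOT proved; N19 NOT discharged (0∕1); K3′
`SpineGivenEndpointR12` (stmt-QuantumFields-19908) NOT claimed — `--supports … --as helper`; counts UNMOVED (discharged 5∕27).  No `def`, no `sorry`, no
`axiom`, no `instance`, no `notation`.  One finite T⁴ programme at fixed `ε` — NOT the continuum limit on ℝ⁴, NOT infinite volume, NOT OS, NOT a mass gap, NOT the
Clay problem.
-/

noncomputable section

namespace Summit.QuantumFields.YangMills.BalabanUVNodes.N19MGFFormKernelChain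

open MeasureTheory ProbabilityTheory ProbabilityTheory.Kernel
open scoped ENNReal

/-! ## §1 MF-Σ: heterogeneous tree-indexed kernel towers are of MGF form -/

section Tower

variable {X : ℕ → Type*} [∀ n, MeasurableSpace (X n)] {ι : ℕ → Type*}

/-
THE DATA OF A TOWER.  Parent maps `init n : ι (n+1) → ι n` (a sequence of length `n+1` restricts to its parent of length `n`), t-FREE step kernels
`κ n s′ : Kernel (X (n+1)) (X n)` (from the level-(n+1) variables back to the level-n variables, one per new sequence `s′` — a MEASURABLE measure-valued map is a
Mathlib kernel), and the HISTORY KERNELS `K n s : Kernel (X n) (X 0)` (from level-`n` fields back to level-0 fields).  The history kernels are characterised by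
TWO RECURSION EQUATIONS, carried as hypotheses so that a consumer builds them by its own recursion (with whatever guards it folds into the step kernels) and no
object is declared here:  `hK0 : K 0 s = Kernel.id`,  `hKs : K (n+1) s′ = K n (init s′) ∘ₖ κ n s′`  (Mathlib `Kernel.comp`; pointwise
`K (n+1) s′ y = (κ n s′ y).bind (K n (init s′))`, `Kernel.comp_apply` — «level k+1 at `V′` = (step measure at `V′`).bind (level k at the parent)»).
-/

variable (init : ∀ n, ι (n + 1) → ι n) (κ : ∀ n, ι (n + 1) → Kernel (X (n + 1)) (X n)) {K : ∀ n, ι n → Kernel (X n) (X 0)}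

/-- The recursion equations in `Measure.bind` form: the history measure at the coarse field `y` is the step measure `κ n s′ y` pushed through the parent's
history kernel (Mathlib `Kernel.comp_apply`). [folklore] -/
theorem histKernel_succ_apply (hKs : ∀ n s', K (n + 1) s' = K n (init n s') ∘ₖ κ n s') (n : ℕ) (s' : ι (n + 1)) (y : X (n + 1)) :
    K (n + 1) s' y = (κ n s' y).bind (K n (init n s')) := by
  rw [hKs, Kernel.comp_apply]

/-- **THE CHAIN LEMMA (MF-Σ).**  A slot family `T n s : X n → ℝ≥0∞` which STARTS at a measurable `f₀` on every length-0 sequence and whose level-(n+1) slot at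
`s′` is the integral of the level-n slot AT THE PARENT `init s′` against the step kernel `κ n s′` IS, at every level and every history, the start integrated
against the history kernel: `T n s = (y ↦ ∫⁻ f₀ ∂(K n s y))` — `DressedMGFFormChain.isKernelRepr_iter` off one space and off one lineage
(Mathlib `Kernel.lintegral_id'`, `Kernel.lintegral_comp`). [folklore] -/
theorem slot_eq_lintegral_histKernel (hK0 : ∀ s, K 0 s = Kernel.id) (hKs : ∀ n s', K (n + 1) s' = K n (init n s') ∘ₖ κ n s')
    {T : ∀ n, ι n → X n → ℝ≥0∞} {f₀ : X 0 → ℝ≥0∞} (hf₀ : Measurable f₀) (h0 : ∀ s, T 0 s = f₀)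
    (hstep : ∀ n s', T (n + 1) s' = fun y => ∫⁻ x, T n (init n s') x ∂(κ n s' y)) :
    ∀ n s, T n s = fun y => ∫⁻ x, f₀ x ∂(K n s y)
  | 0, s => by
      funext y
      rw [h0 s, hK0, Kernel.lintegral_id' hf₀]
  | n + 1, s' => by
      have ih := slot_eq_lintegral_histKernel hK0 hKs hf₀ h0 hstep n (init n s')
      funext y
      rw [hstep n s', hKs, Kernel.lintegral_comp _ _ _ hf₀, ih]

/-- Hence every slot is measurable. [folklore] -/
theorem measurable_slot (hK0 : ∀ s, K 0 s = Kernel.id) (hKs : ∀ n s', K (n + 1) s' = K n (init n s') ∘ₖ κ n s')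
    {T : ∀ n, ι n → X n → ℝ≥0∞} {f₀ : X 0 → ℝ≥0∞} (hf₀ : Measurable f₀) (h0 : ∀ s, T 0 s = f₀)
    (hstep : ∀ n s', T (n + 1) s' = fun y => ∫⁻ x, T n (init n s') x ∂(κ n s' y)) (n : ℕ) (s : ι n) : Measurable (T n s) := by
  rw [slot_eq_lintegral_histKernel init κ hK0 hKs hf₀ h0 hstep n s]
  exact hf₀.lintegral_kernel

/-- **THE CLASS WEIGHT IS AN INTEGRAL ON THE LEVEL-0 SPACE**: for a measurable front factor `χ` on level `n` and any measure `μ` there,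
`∫⁻ χ·T n s dμ = ∫⁻ f₀ d((μ.withDensity χ).bind (K n s))` (Mathlib `Measure.lintegral_bind`). [folklore] -/
theorem lintegral_mul_slot_eq_lintegral_bind (hK0 : ∀ s, K 0 s = Kernel.id) (hKs : ∀ n s', K (n + 1) s' = K n (init n s') ∘ₖ κ n s')
    {T : ∀ n, ι n → X n → ℝ≥0∞} {f₀ : X 0 → ℝ≥0∞} (hf₀ : Measurable f₀) (h0 : ∀ s, T 0 s = f₀)
    (hstep : ∀ n s', T (n + 1) s' = fun y => ∫⁻ x, T n (init n s') x ∂(κ n s' y)) (n : ℕ) (s : ι n) (μ : Measure (X n))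
    {χ : X n → ℝ≥0∞} (hχ : Measurable χ) :
    ∫⁻ y, χ y * T n s y ∂μ = ∫⁻ x, f₀ x ∂((μ.withDensity χ).bind (K n s)) := by
  rw [Measure.lintegral_bind (Kernel.aemeasurable _) hf₀.aemeasurable,
    lintegral_withDensity_eq_lintegral_mul _ hχ hf₀.lintegral_kernel]
  refine lintegral_congr fun y => ?_
  rw [slot_eq_lintegral_histKernel init κ hK0 hKs hf₀ h0 hstep n s]
  rfl

/-- **MGF FORM OF EVERY HISTORY (MF-Σ, dressed).**  For t-free step and history kernels, a measurable undressed start `ρ₀`, a measurable observable `F` on the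
level-0 space and a source `t`: a slot family started at the DRESSED start `ρ₀·e^{tF}` and propagated by the step kernels has, for every level `n`, history `s`,
measure `μ` and measurable front factor `χ` on level `n`, class weight `(∫⁻ χ·T n s dμ).toReal = mgf F ν t` under THE KERNEL-DUAL CLASS MEASURE
`ν = (((μ.withDensity χ).bind (K n s)).withDensity ρ₀)` on the level-0 space — `DressedMGFFormChain.toReal_lintegral_iter_dressed_eq_mgf` :166 off one space and off
one lineage; `ν` does not see `t` (front factor against `μ`, pulled back through the history kernel, undressed start as density); both sides `0` together when the
class weight is infinite. [folklore] -/
theorem toReal_lintegral_mul_slot_dressed_eq_mgf (hK0 : ∀ s, K 0 s = Kernel.id) (hKs : ∀ n s', K (n + 1) s' = K n (init n s') ∘ₖ κ n s')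
    {ρ₀ : X 0 → ℝ≥0∞} (hρ₀ : Measurable ρ₀) {F : X 0 → ℝ} (hF : Measurable F) (t : ℝ)
    {T : ∀ n, ι n → X n → ℝ≥0∞} (h0 : ∀ s, T 0 s = fun x => ρ₀ x * ENNReal.ofReal (Real.exp (t * F x)))
    (hstep : ∀ n s', T (n + 1) s' = fun y => ∫⁻ x, T n (init n s') x ∂(κ n s' y)) (n : ℕ) (s : ι n) (μ : Measure (X n))
    {χ : X n → ℝ≥0∞} (hχ : Measurable χ) :
    (∫⁻ y, χ y * T n s y ∂μ).toReal = mgf F (((μ.withDensity χ).bind (K n s)).withDensity ρ₀) t := by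
  have hw : Measurable fun x => ENNReal.ofReal (Real.exp (t * F x)) :=
    ENNReal.measurable_ofReal.comp (Real.measurable_exp.comp (hF.const_mul t))
  rw [lintegral_mul_slot_eq_lintegral_bind init κ hK0 hKs (hρ₀.mul hw) h0 hstep n s μ hχ,
    ← lintegral_withDensity_eq_lintegral_mul _ hρ₀ hw, mgf,
    integral_eq_lintegral_of_nonneg_ae (ae_of_all _ fun x => (Real.exp_pos _).le)
      (Real.measurable_exp.comp (hF.const_mul t)).aestronglyMeasurable]

/-- **FINITENESS OF THE CLASS MEASURE FROM THE UNDRESSED CLASS WEIGHT**: if the slot family started at the UNDRESSED start `ρ₀` has a finite class weight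
`∫⁻ χ·T⁰ n s dμ ≠ ∞`, the kernel-dual class measure of that history is finite (its mass IS that class weight, `kernelDual_univ`). [folklore] -/
theorem isFiniteMeasure_kernelDual_of_lintegral_ne_top (hK0 : ∀ s, K 0 s = Kernel.id)
    (hKs : ∀ n s', K (n + 1) s' = K n (init n s') ∘ₖ κ n s') {ρ₀ : X 0 → ℝ≥0∞} (hρ₀ : Measurable ρ₀) {T₀ : ∀ n, ι n → X n → ℝ≥0∞}
    (h0 : ∀ s, T₀ 0 s = ρ₀) (hstep : ∀ n s', T₀ (n + 1) s' = fun y => ∫⁻ x, T₀ n (init n s') x ∂(κ n s' y)) (n : ℕ) (s : ι n)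
    (μ : Measure (X n)) {χ : X n → ℝ≥0∞} (hχ : Measurable χ) (hfin : ∫⁻ y, χ y * T₀ n s y ∂μ ≠ ∞) :
    IsFiniteMeasure (((μ.withDensity χ).bind (K n s)).withDensity ρ₀) := by
  refine isFiniteMeasure_withDensity ?_
  rwa [← lintegral_mul_slot_eq_lintegral_bind init κ hK0 hKs hρ₀ h0 hstep n s μ hχ]

/-- The mass of the class measure IS the undressed class weight. [folklore] -/
theorem kernelDual_univ (hK0 : ∀ s, K 0 s = Kernel.id) (hKs : ∀ n s', K (n + 1) s' = K n (init n s') ∘ₖ κ n s')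
    {ρ₀ : X 0 → ℝ≥0∞} (hρ₀ : Measurable ρ₀) {T₀ : ∀ n, ι n → X n → ℝ≥0∞}
    (h0 : ∀ s, T₀ 0 s = ρ₀) (hstep : ∀ n s', T₀ (n + 1) s' = fun y => ∫⁻ x, T₀ n (init n s') x ∂(κ n s' y)) (n : ℕ) (s : ι n)
    (μ : Measure (X n)) {χ : X n → ℝ≥0∞} (hχ : Measurable χ) :
    ((μ.withDensity χ).bind (K n s)).withDensity ρ₀ Set.univ = ∫⁻ y, χ y * T₀ n s y ∂μ := by
  rw [withDensity_apply _ MeasurableSet.univ, Measure.restrict_univ,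
    lintegral_mul_slot_eq_lintegral_bind init κ hK0 hKs hρ₀ h0 hstep n s μ hχ]

/-- The undressed history masses bound: `∫⁻ ρ₀ ∂(K n s y)` IS the slot `T₀ n s y` of the undressed tower (a restatement of the chain lemma used by §1b's
finiteness proviso). [folklore] -/
theorem lintegral_histKernel_eq_slot (hK0 : ∀ s, K 0 s = Kernel.id) (hKs : ∀ n s', K (n + 1) s' = K n (init n s') ∘ₖ κ n s')
    {ρ₀ : X 0 → ℝ≥0∞} (hρ₀ : Measurable ρ₀) {T₀ : ∀ n, ι n → X n → ℝ≥0∞}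
    (h0 : ∀ s, T₀ 0 s = ρ₀) (hstep : ∀ n s', T₀ (n + 1) s' = fun y => ∫⁻ x, T₀ n (init n s') x ∂(κ n s' y)) (n : ℕ) (s : ι n)
    (y : X n) : ∫⁻ x, ρ₀ x ∂(K n s y) = T₀ n s y := by
  rw [slot_eq_lintegral_histKernel init κ hK0 hKs hρ₀ h0 hstep n s]

end Tower

/-! ### Packaging a run-indexed family of towers into `DressedMGFForm.MGFForm` -/

section Packaging

open Summit.QuantumFields.BalabanUV.T4Continuum.NE1p.DressedMGFForm

variable {X : ℕ → ℕ → Type*} [∀ K n, MeasurableSpace (X K n)] {ι : ℕ → ℕ → Type*}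

/-- **`MGFForm` FROM KERNEL TOWERS (the road's displayed hypothesis, generic shape; NO integrability binder).**  Per run `K`: a tower datum on the level-indexed
spaces `X K n` (parent maps `init K`, t-free step kernels `κ K`, history kernels `Kh K` obeying the two recursion equations), an undressed start `ρ₀ K`, an
observable `F K` with `|F K| ≤ B` on the level-0 space, a depth `d K`, and for every class `τ` a history `seq K τ` of length `d K`, a front factor `χ K τ` and a
reference measure `μ K` on level `d K`; the dressed class terms `A K t τ` are the `toReal` class weights of the slot families `T K t` started at `ρ₀ K · e^{t F K}` and
propagated by the step kernels (`h0`, `hstep`), and the UNDRESSED (`t = 0`) class weights are finite.  Then `MGFForm B Tcl F ν A` with the kernel-dual class measures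
`ν K τ = (((μ K).withDensity (χ K τ)).bind (Kh K (d K) (seq K τ))).withDensity (ρ₀ K)` EXPLICIT and t-free. [folklore] -/
theorem mgfForm_of_kernelTowers {ι' : Type*} {B : ℝ} (hB : 0 ≤ B) (Tcl : ℕ → Finset ι')
    (init : ∀ K n, ι K (n + 1) → ι K n) (κ : ∀ K n, ι K (n + 1) → Kernel (X K (n + 1)) (X K n))
    {Kh : ∀ K n, ι K n → Kernel (X K n) (X K 0)} (hK0 : ∀ K s, Kh K 0 s = Kernel.id)
    (hKs : ∀ K n s', Kh K (n + 1) s' = Kh K n (init K n s') ∘ₖ κ K n s')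
    {ρ₀ : ∀ K, X K 0 → ℝ≥0∞} (hρ₀ : ∀ K, Measurable (ρ₀ K)) {F : ∀ K, X K 0 → ℝ} (hFm : ∀ K, Measurable (F K))
    (hFb : ∀ K x, |F K x| ≤ B) (d : ℕ → ℕ) (seq : ∀ K, ι' → ι K (d K)) (μ : ∀ K, Measure (X K (d K)))
    {χ : ∀ K, ι' → X K (d K) → ℝ≥0∞} (hχ : ∀ K τ, Measurable (χ K τ))
    {T : ∀ K, ℝ → ∀ n, ι K n → X K n → ℝ≥0∞}
    (h0 : ∀ K t s, T K t 0 s = fun x => ρ₀ K x * ENNReal.ofReal (Real.exp (t * F K x)))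
    (hstep : ∀ K t n s', T K t (n + 1) s' = fun y => ∫⁻ x, T K t n (init K n s') x ∂(κ K n s' y))
    (hfin : ∀ K, ∀ τ ∈ Tcl K, ∫⁻ y, χ K τ y * T K 0 (d K) (seq K τ) y ∂μ K ≠ ∞)
    {A : ℕ → ℝ → ι' → ℝ} (hA : ∀ K t, ∀ τ ∈ Tcl K, A K t τ = (∫⁻ y, χ K τ y * T K t (d K) (seq K τ) y ∂μ K).toReal) :
    MGFForm B Tcl F (fun K τ => (((μ K).withDensity (χ K τ)).bind (Kh K (d K) (seq K τ))).withDensity (ρ₀ K)) A where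
  nonneg := hB
  meas := hFm
  bound := hFb
  finite := fun K τ hτ => by
    have h00 : ∀ s, T K 0 0 s = ρ₀ K := fun s => by
      rw [h0 K 0 s]; funext x; simp
    exact isFiniteMeasure_kernelDual_of_lintegral_ne_top (init K) (κ K) (hK0 K) (hKs K) (hρ₀ K) h00 (hstep K 0) (d K) (seq K τ)
      (μ K) (hχ K τ) (hfin K τ hτ)
  repr := fun K t τ hτ => by
    rw [hA K t τ hτ]
    exact toReal_lintegral_mul_slot_dressed_eq_mgf (init K) (κ K) (hK0 K) (hKs K) (hρ₀ K) (hFm K) t (h0 K t) (hstep K t) (d K)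
      (seq K τ) (μ K) (hχ K τ)

end Packaging

/-! ## §1b The real-valued bridge, in def-T's junk convention: Bochner-integral slot families ARE `toReal` of the `ℝ≥0∞` tower — no integrability binder -/

section RealBridge

variable {X : ℕ → Type*} [∀ n, MeasurableSpace (X n)] {ι : ℕ → Type*}
variable (init : ∀ n, ι (n + 1) → ι n) (κ : ∀ n, ι (n + 1) → Kernel (X (n + 1)) (X n)) {K : ∀ n, ι n → Kernel (X n) (X 0)}

/-- The CANONICAL `ℝ≥0∞` tower `(n, s) ↦ (y ↦ ∫⁻ f₀ ∂(K n s y))` of a family of history kernels satisfies the start and step equations of §1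
(`Kernel.lintegral_id'`, `Kernel.lintegral_comp`). [folklore] -/
theorem lintegral_histKernel_tower (hK0 : ∀ s, K 0 s = Kernel.id) (hKs : ∀ n s', K (n + 1) s' = K n (init n s') ∘ₖ κ n s')
    {f₀ : X 0 → ℝ≥0∞} (hf₀ : Measurable f₀) :
    (∀ s : ι 0, (fun y => ∫⁻ x, f₀ x ∂(K 0 s y)) = f₀) ∧
      ∀ n (s' : ι (n + 1)), (fun y => ∫⁻ x, f₀ x ∂(K (n + 1) s' y))
        = fun y => ∫⁻ x, (fun z => ∫⁻ x, f₀ x ∂(K n (init n s') z)) x ∂(κ n s' y) := by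
  refine ⟨fun s => ?_, fun n s' => ?_⟩
  · funext y
    rw [hK0, Kernel.lintegral_id' hf₀]
  · funext y
    rw [hKs, Kernel.lintegral_comp _ _ _ hf₀]

omit [∀ n, MeasurableSpace (X n)] in
/-- For a dressed start `ρ₀·e^{tF}` with `|F| ≤ B`, finiteness of the UNDRESSED mass gives finiteness of the dressed one under any measure
(`e^{tF} ≤ e^{|t|B}`). [folklore] -/
theorem lintegral_dressed_ne_top {mX : MeasurableSpace (X 0)} {ρ₀ : X 0 → ℝ≥0∞} {F : X 0 → ℝ} {B : ℝ} (hFb : ∀ x, |F x| ≤ B) (t : ℝ)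
    (ν : Measure (X 0)) (hfin : ∫⁻ x, ρ₀ x ∂ν ≠ ∞) : ∫⁻ x, ρ₀ x * ENNReal.ofReal (Real.exp (t * F x)) ∂ν ≠ ∞ := by
  have hle : ∀ x, ρ₀ x * ENNReal.ofReal (Real.exp (t * F x)) ≤ ENNReal.ofReal (Real.exp (|t| * B)) * ρ₀ x := fun x => by
    rw [mul_comm]
    refine mul_le_mul' (ENNReal.ofReal_le_ofReal (Real.exp_le_exp.mpr ?_)) le_rfl
    calc t * F x ≤ |t * F x| := le_abs_self _
      _ = |t| * |F x| := abs_mul _ _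
      _ ≤ |t| * B := mul_le_mul_of_nonneg_left (hFb x) (abs_nonneg t)
  refine ne_top_of_le_ne_top ?_ (lintegral_mono hle)
  rw [lintegral_const_mul' _ _ ENNReal.ofReal_ne_top]
  exact ENNReal.mul_ne_top ENNReal.ofReal_ne_top hfin

/-- **THE REAL-VALUED BRIDGE, JUNK-MATCHED.**  A REAL slot family `Tr n s : X n → ℝ` which starts at `(f₀ ·).toReal` for a measurable `f₀ : X 0 → ℝ≥0∞` and whose
level-(n+1) slot at `s′` is the BOCHNER integral of the level-n slot at the parent `init s′` against the step kernel `κ n s′ y` IS, at every level, `toReal` of the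
`ℝ≥0∞` tower `y ↦ ∫⁻ f₀ ∂(K n s y)` — under ONE Bochner-free proviso on the KERNELS: every history gives `f₀` finite mass (`hfin`; a guard a concrete recursion can
fold into its step kernels).  NO integrability binder: `∫ = toReal ∘ ∫⁻` for non-negative a.e.-strongly-measurable integrands holds unconditionally
(Mathlib `integral_eq_lintegral_of_nonneg_ae` — def-T's convention `toReal ∞ = 0` on the nose) and `hfin` lets `ofReal ∘ toReal` cancel along the parent's fibre.
[folklore] -/
theorem realSlot_eq_toReal_slot (hK0 : ∀ s, K 0 s = Kernel.id) (hKs : ∀ n s', K (n + 1) s' = K n (init n s') ∘ₖ κ n s')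
    {Tr : ∀ n, ι n → X n → ℝ} {f₀ : X 0 → ℝ≥0∞} (hf₀ : Measurable f₀) (hfin : ∀ n s y, ∫⁻ x, f₀ x ∂(K n s y) ≠ ∞)
    (h0 : ∀ s, Tr 0 s = fun x => (f₀ x).toReal)
    (hstep : ∀ n s' y, Tr (n + 1) s' y = ∫ x, Tr n (init n s') x ∂(κ n s' y)) :
    ∀ n s, Tr n s = fun y => (∫⁻ x, f₀ x ∂(K n s y)).toReal
  | 0, s => by
      funext y
      rw [h0 s, hK0, Kernel.lintegral_id' hf₀]
  | n + 1, s' => by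
      have ih := realSlot_eq_toReal_slot hK0 hKs hf₀ hfin h0 hstep n (init n s')
      have hL : Measurable fun x => ∫⁻ z, f₀ z ∂(K n (init n s') x) := hf₀.lintegral_kernel
      funext y
      have hnn : 0 ≤ᵐ[κ n s' y] Tr n (init n s') := ae_of_all _ fun x => by
        show (0 : ℝ) ≤ Tr n (init n s') x
        rw [ih]; exact ENNReal.toReal_nonneg
      have hsm : AEStronglyMeasurable (Tr n (init n s')) (κ n s' y) := by
        rw [ih]; exact hL.ennreal_toReal.aestronglyMeasurable
      rw [hstep n s' y, integral_eq_lintegral_of_nonneg_ae hnn hsm, hKs, Kernel.lintegral_comp _ _ _ hf₀]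
      congr 1
      refine lintegral_congr fun x => ?_
      rw [ih]
      exact ENNReal.ofReal_toReal (hfin n (init n s') x)

/-- Hence every real slot is non-negative and measurable. [folklore] -/
theorem realSlot_nonneg_measurable (hK0 : ∀ s, K 0 s = Kernel.id) (hKs : ∀ n s', K (n + 1) s' = K n (init n s') ∘ₖ κ n s')
    {Tr : ∀ n, ι n → X n → ℝ} {f₀ : X 0 → ℝ≥0∞} (hf₀ : Measurable f₀) (hfin : ∀ n s y, ∫⁻ x, f₀ x ∂(K n s y) ≠ ∞)
    (h0 : ∀ s, Tr 0 s = fun x => (f₀ x).toReal)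
    (hstep : ∀ n s' y, Tr (n + 1) s' y = ∫ x, Tr n (init n s') x ∂(κ n s' y)) (n : ℕ) (s : ι n) :
    (∀ y, 0 ≤ Tr n s y) ∧ Measurable (Tr n s) := by
  rw [realSlot_eq_toReal_slot init κ hK0 hKs hf₀ hfin h0 hstep n s]
  exact ⟨fun _ => ENNReal.toReal_nonneg, (hf₀.lintegral_kernel).ennreal_toReal⟩

/-- **THE REAL CLASS WEIGHT OF A DRESSED REAL TOWER IS THE MGF — no integrability binder.**  Real slots started at `(ρ₀ x).toReal · e^{t F x}` (measurable `ρ₀`,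
measurable `F` with `|F| ≤ B`), propagated by BOCHNER integration against the t-free step kernels, the history kernels giving the UNDRESSED start finite mass
everywhere (`hfin`, t-free); then for every measurable non-negative REAL front factor `χ` on level `n` and every measure `μ` there:
`∫ χ·Tr n s dμ = mgf F ((((μ.withDensity (ofReal ∘ χ)).bind (K n s)).withDensity ρ₀)) t` — both sides `0` together when the class weight is infinite.  The literal
shape of F3's `classWeightOfDatum₉` (a Bochner integral of `χ_k(s)·slot_k(s)` over `fieldMeasure`). [folklore] -/
theorem integral_mul_realSlot_dressed_eq_mgf (hK0 : ∀ s, K 0 s = Kernel.id) (hKs : ∀ n s', K (n + 1) s' = K n (init n s') ∘ₖ κ n s')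
    {ρ₀ : X 0 → ℝ≥0∞} (hρ₀ : Measurable ρ₀) {F : X 0 → ℝ} (hF : Measurable F) {B : ℝ} (hFb : ∀ x, |F x| ≤ B) (t : ℝ)
    (hfin : ∀ n s y, ∫⁻ x, ρ₀ x ∂(K n s y) ≠ ∞) {Tr : ∀ n, ι n → X n → ℝ}
    (h0 : ∀ s, Tr 0 s = fun x => (ρ₀ x).toReal * Real.exp (t * F x))
    (hstep : ∀ n s' y, Tr (n + 1) s' y = ∫ x, Tr n (init n s') x ∂(κ n s' y)) (n : ℕ) (s : ι n) (μ : Measure (X n))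
    {χ : X n → ℝ} (hχ : Measurable χ) (hχ0 : ∀ y, 0 ≤ χ y) :
    ∫ y, χ y * Tr n s y ∂μ = mgf F (((μ.withDensity fun y => ENNReal.ofReal (χ y)).bind (K n s)).withDensity ρ₀) t := by
  -- the dressed start as an `ℝ≥0∞` density: measurable, finite history masses
  set f₀ : X 0 → ℝ≥0∞ := fun x => ρ₀ x * ENNReal.ofReal (Real.exp (t * F x)) with hf₀_def
  have hw : Measurable fun x => ENNReal.ofReal (Real.exp (t * F x)) :=
    ENNReal.measurable_ofReal.comp (Real.measurable_exp.comp (hF.const_mul t))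
  have hf₀ : Measurable f₀ := hρ₀.mul hw
  have hf₀fin : ∀ n s y, ∫⁻ x, f₀ x ∂(K n s y) ≠ ∞ := fun n s y =>
    lintegral_dressed_ne_top hFb t _ (hfin n s y)
  have h0' : ∀ s, Tr 0 s = fun x => (f₀ x).toReal := fun s => by
    rw [h0 s]; funext x
    rw [hf₀_def, ENNReal.toReal_mul, ENNReal.toReal_ofReal (Real.exp_pos _).le]
  have hbr := realSlot_eq_toReal_slot init κ hK0 hKs hf₀ hf₀fin h0' hstep n s
  -- the canonical `ℝ≥0∞` tower and its class weight
  obtain ⟨hT0, hTs⟩ := lintegral_histKernel_tower init κ hK0 hKs hf₀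
  have hχ' : Measurable (fun y => ENNReal.ofReal (χ y)) := ENNReal.measurable_ofReal.comp hχ
  have hmgf := toReal_lintegral_mul_slot_dressed_eq_mgf init κ hK0 hKs hρ₀ hF t
    (T := fun n s y => ∫⁻ x, f₀ x ∂(K n s y)) hT0 hTs n s μ hχ'
  rw [← hmgf]
  have hnn : 0 ≤ᵐ[μ] fun y => χ y * Tr n s y := ae_of_all _ fun y => by
    show (0 : ℝ) ≤ χ y * Tr n s y
    refine mul_nonneg (hχ0 y) ?_
    rw [hbr]; exact ENNReal.toReal_nonneg
  have hsm : AEStronglyMeasurable (fun y => χ y * Tr n s y) μ := by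
    rw [hbr]
    exact (hχ.mul (hf₀.lintegral_kernel).ennreal_toReal).aestronglyMeasurable
  rw [integral_eq_lintegral_of_nonneg_ae hnn hsm]
  congr 1
  refine lintegral_congr fun y => ?_
  rw [ENNReal.ofReal_mul (hχ0 y), hbr]
  exact congrArg _ (ENNReal.ofReal_toReal (hf₀fin n s y))

end RealBridge

end Summit.QuantumFields.YangMills.BalabanUVNodes.N19MGFFormKernelChain

end
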